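import Summits.BirchSwinnertonDyer.BirchSwinnertonDyer.Theorems.ErratumRoadFiveEulerHalfNotRamPAnchorDegree
import Summits.BirchSwinnertonDyer.BirchSwinnertonDyer.Theorems.ErratumRoadFiveEulerHalfNotRamInertUpToOne
import Summits.BirchSwinnertonDyer.BirchSwinnertonDyer.Theorems.ErratumRoadFiveEulerHalfNotRamInert
import Summits.BirchSwinnertonDyer.Rank1Residual.X11b.BDPRouteRTDegreeCokerUnits
import Literature.NumberTheory.EllipticCurves.QuadraticTwistLocalDataAtTwoHoldsProofs
import Summits.BirchSwinnertonDyer.BirchSwinnertonDyer.Theorems.ErratumRoadFiveShimuraSkolemPackageCoker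
import Summits.BirchSwinnertonDyer.BirchSwinnertonDyer.Theorems.ErratumRoadFiveEulerHalfNotRamInertSavedOfCarrierLabels
import Summits.BirchSwinnertonDyer.BirchSwinnertonDyer.Theorems.ErratumRoadFiveShimuraKolyvaginOrderBoundInertOfPrimitivesFromFive
import Summits.BirchSwinnertonDyer.BirchSwinnertonDyer.Theorems.ClassRecordThreeEulerHalvesAtThreePoitouTateOfCanonical
import HarnessLib

/-!
# Route `ErratumRoadFive` (K2, `p ≥ 5`), crux `EulerHalfNotRamNoInertSetAtFive` (item stmt-BirchSwinnertonDyer-19715), line `birth`: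
# THE `p`-ANCHOR, §3 of 4 — THE EXTRA-PLACE CORE WITHOUT A (DEG) DATUM (one exempted offending carrier `q₁ ∉ S`, its display SAVED by Jetchev's bound —
# HOLE 1 of the line; even multiplicative `S ∋ p` containing the other offenders) ⟹ `Typed.MissingUpperBoundAt W p`
# (cell `bsd-stepL`, lead seat `bsd-line-er5-p1` g1; `--supports stmt-BirchSwinnertonDyer-19715 --as helper`)

WHAT. `Theorems.missingUpperBoundAt_of_classX11b_of_inertSet_of_extraPlace_odd_of_twinLowerD` (corner3-p2 ∕ corner-p1, the D-form core) VERBATIM except: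
binders `5 ≤ p`, `Surj W p` added (only `p ≠ 2` is used by the anchor; kept for the callers' shape) and the `hdegDatum` binder is GONE (`p`-last telescope of
§1 on `S ∋ p`). CONDITIONAL on every binder (the saved display `hHKs` is HOLE 1); nothing booked.

Credit: the `p`-anchor is the critic idea-crit-14's (VERDICT #29, scratch `ResidualMem.lean` 1c5fc830ef431d01) and the ideator bsd-idea-9 g4's
(crux workfile `Cruxes/EulerHalfNotRamNoInertSetAtFive/Lines/coker_units_surj.lean` v4, sha16 ea858e0da1dbc78d, farm rc 0 · 0 sorries, re-checked by the LEAD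
from its own folder); crux workfiles are not importable, so the LEAD moves the text to `Theorems/` VERBATIM (statements and proofs unchanged; namespace
`Theorems.EulerHalfPAnchor`). HONEST FRAMING: THEOREMS ONLY, CONDITIONAL on their displayed hypotheses (route items by name, the typed saved display ∕ LAB =
HOLE 1, printed named facts); no `sorry`, no definition, no new named fact; nothing booked; item 19715 is NOT closed; BSD is proved for no curve; no summit
statement is touched.
[cite: Jetchev2008, Thm. 1.1, Cor. 1.5] [cite: PastenShimura2024, Prop. 6.13, Lemma 6.15, Lemma 6.18] [cite: RibetTakahashi1997, Thm. 1–2]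
-/

set_option autoImplicit false
set_option linter.dupNamespace false

noncomputable section

open scoped Classical

open WeierstrassCurve Literature.NumberTheory.EllipticCurves Literature.NumberTheory.EllipticCurves.BarriosEtAl2025
  Literature.NumberTheory.EllipticCurves.ModularForms Literature.NumberTheory.EllipticCurves.Rank1Residual
  Literature.NumberTheory.EllipticCurves.Rank1Residual.Typed Literature.NumberTheory.Automorphic
  Summit.BirchSwinnertonDyer.Rank1Residual Summit.BirchSwinnertonDyer.Rank1Residual.X11b

open NumberField IsDedekindDomain Rat.HeightOneSpectrum CongruenceSubgroup
  Literature.NumberTheory.EllipticCurves.Wuthrich2014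
  Literature.NumberTheory.EllipticCurves.BalakrishnanEtAl2019
  Literature.NumberTheory.QuadraticFields.Quadratic
  Summit.BirchSwinnertonDyer.BirchSwinnertonDyer.Theorems

namespace Summit.BirchSwinnertonDyer.BirchSwinnertonDyer.Theorems.EulerHalfPAnchor

/-- **The extra-place core via the `p`-anchor** — `Theorems.missingUpperBoundAt_of_classX11b_of_inertSet_of_extraPlace_odd_of_twinLowerD` (corner3-p2)
VERBATIM except: binders `5 ≤ p`, `Surj W p` are added (only `p ≠ 2` is used by the anchor; kept for the callers' shape) and the `hdegDatum` binder is
GONE (`p`-last telescope of §4 on `S ∋ p`). CONDITIONAL on every binder (the saved display `hHKs` is HOLE 1); nothing booked.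
-- adapted from Summits/BirchSwinnertonDyer/BirchSwinnertonDyer/Theorems/ClassRecordThreeCornerAtThreeUpperShimuraInertSavingOfTwinLowerD.lean
[cite: Jetchev2008, Thm. 1.1, Cor. 1.5] [cite: PastenShimura2024, Prop. 6.13, Lemma 6.15, Lemma 6.18] -/
theorem missingUpperBoundAt_of_classX11b_of_inertSet_of_extraPlace_odd_of_twinLowerD_pAnchor
    -- published inputs (named facts of the tree)
    (hGZK : rank_eq_analyticRank_of_analyticRank_le_one) (hmod : hasEntireLFunction_rat)
    (hnf : exists_isNewformOf)
    (hMaz : mazur_not_dvd_maninConstant_of_odd)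
    (hBR : localTamagawaNumber_quadraticTwist_two_mem_of_goodReduction)
    (hJL : nonempty_shimuraParametrizationData)
    (hCO : PastenShimura2024_componentOrders)
    -- the pair: X11b, `p` odd (image irreducible, surjective or not; a (ram) prime or none)
    (W : WeierstrassCurve ℚ) [W.IsElliptic] [W.IsGloballyMinimal] (p : ℕ) [Fact p.Prime]
    (hX : ClassX11b W p) (hp5 : 5 ≤ p) (hsurj : Surj W p)
    -- the EXEMPTED place: ONE bad prime `q₁` (the intended one: the (T2γ) carrier), outside `S` below
    (q₁ : ℕ) [Fact q₁.Prime] (hbad₁ : ¬ W.HasGoodReductionAtPrime q₁)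
    -- the TAMAGAWA SHAPE off `q₁`: every prime `q ≠ q₁` with `p ∣ c_q(E)` is split multiplicative
    (hshape : ∀ (q : ℕ) [Fact q.Prime], q ≠ q₁ → p ∣ (W.baseChange ℚ_[q]).localTamagawaNumber ℤ_[q] →
      W.HasSplitMultiplicativeReductionAtPrime q)
    -- the INERT Heegner-point display at the pair WITH THE SAVING AT `q₁`, asked ONLY at `K` with `d_K < −4` (raw body of
    -- `Theorems.ShimuraInertSavedDisplayAtD W p q₁`: Gross–Zagier on `X_{N⁺,N⁻}`, `p ∈ S` inert, degree link, and the SAVED order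
    -- bound `ord_p #Ш(E/K)[p^∞] + 2·ord_p c_{q₁}(E) ≤ 2·ord_p [E(K):ℤP]`)
    (hHKs : ∀ (N : ℕ) [NeZero N] (K : Type) [Field K] [NumberField K] (S : Finset ℕ)
      (Dt : ModularParametrizationData W N)
      (X : ShimuraCurveData (∏ q ∈ S, q) (N / ∏ q ∈ S, q))
      (W' : WeierstrassCurve ℚ) [W'.IsElliptic] (P₀ : ShimuraParametrizationData X W'),
      W.conductorNorm ℤ = N → IsImaginaryQuadratic K → NumberField.discr K < -4 → Even S.card →
      (∀ ℓ ∈ S, ℓ.Prime ∧ ℓ ∣ N ∧ ¬ ℓ ^ 2 ∣ N ∧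
        ((Ideal.span {(ℓ : ℤ)}).primesOver (𝓞 K)).ncard = 1 ∧ ¬ (ℓ : ℤ) ∣ NumberField.discr K) →
      (∀ ℓ : ℕ, ℓ.Prime → ℓ ∣ N → ℓ ∉ S → ((Ideal.span {(ℓ : ℤ)}).primesOver (𝓞 K)).ncard = 2) →
      p ∈ S → ¬ (p : ℤ) ∣ Dt.c → P₀.IsMinimalFor W →
      ∃ (P : (W.baseChange K).toAffine.Point) (degS : ℕ), 0 < degS ∧
        padicValNat p degS = padicValNat p P₀.deg ∧
        LDerivEK W K =
          8 * (Real.pi : ℂ) ^ 2 * peterssonProduct (Gamma0 N) 2 Dt.f Dt.f /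
              ((((Units.torsionOrder K : ℝ) / 2) ^ 2 * √|(NumberField.discr K : ℝ)| : ℝ) : ℂ) *
            ((P.canonicalHeight : ℂ) / (degS : ℂ)) ∧
        (¬ IsOfFinAddOrder P → q₁ ∉ S →
          padicValNat p (Nat.card (AddCommGroup.primaryComponent (W.baseChange K).sha p)) +
              2 * padicValNat p ((W.baseChange ℚ_[q₁]).localTamagawaNumber ℤ_[q₁]) ≤
            2 * padicValNat p (AddSubgroup.zmultiples P).index))
    -- the TWIN-LOWER SUPPLY at a carrier-inert Friedberg–Hoffstein frame (raw body of `Theorems.FHTwinLowerSupplyAt W p`)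
    (hTL : ∀ (T : Finset ℕ), (∀ ℓ ∈ T, ∃ _ : Fact ℓ.Prime, Mult W ℓ) → Even T.card →
      ∃ (K : Type) (_ : Field K) (_ : NumberField K)
        (Wd : WeierstrassCurve ℚ) (_ : Wd.IsElliptic) (_ : Wd.IsGloballyMinimal) (Cd : VariableChange ℚ),
        IsImaginaryQuadratic K ∧ 4 < (NumberField.discr K).natAbs ∧
        (∀ ℓ ∈ T, ((Ideal.span {(ℓ : ℤ)}).primesOver (𝓞 K)).ncard = 1 ∧ ¬ (ℓ : ℤ) ∣ NumberField.discr K) ∧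
        (∀ ℓ : ℕ, ℓ.Prime → ℓ ∣ W.conductorNorm ℤ → ℓ ∉ T →
          ((Ideal.span {(ℓ : ℤ)}).primesOver (𝓞 K)).ncard = 2) ∧
        (W.quadraticTwist (NumberField.discr K : ℚ)).entireLFunction 1 ≠ 0 ∧
        Cd • W.quadraticTwist (NumberField.discr K : ℚ) = Wd ∧
        ∃ q : ℚ, Wd.entireLFunction 1 / (Wd.realPeriodRat : ℂ) = (q : ℂ) ∧
          padicValRat p q ≤ (padicValNat p Wd.shaOrder : ℤ) + padicValNat p Wd.tamagawaProduct -
            2 * padicValNat p Wd.torsionOrder)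
    -- the inert set: even, multiplicative, containing `p` and every offending prime off `q₁`, missing `q₁`
    (S : Finset ℕ) (hSmult : ∀ ℓ ∈ S, ∃ _ : Fact ℓ.Prime, Mult W ℓ) (hSeven : Even S.card)
    (hpS : p ∈ S) (hq₁S : q₁ ∉ S)
    (hFC : ∀ (ℓ : ℕ) [Fact ℓ.Prime], ℓ ∉ S → ℓ ≠ q₁ → W.HasSplitMultiplicativeReductionAtPrime ℓ →
      ¬ p ∣ padicValInt ℓ W.minimalDiscriminantInt) :
    Typed.MissingUpperBoundAt W p := by
  have hNS : integral_neronScaling_of_isGloballyMinimal :=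
    integral_neronScaling_of_isGloballyMinimal_holds
  have hp : p.Prime := Fact.out
  obtain ⟨hr, hp2, hmult, hirr⟩ := id hX
  have hNpos : 0 < W.conductorNorm ℤ := W.conductorNorm_pos_holds
  have hN0 : W.conductorNorm ℤ ≠ 0 := hNpos.ne'
  haveI : NeZero (W.conductorNorm ℤ) := ⟨hN0⟩
  -- the set of multiplicative primes
  set Mlt : Finset ℕ := (W.conductorNorm ℤ).primeFactors.filter
    (fun q ↦ ∃ h : q.Prime, @WeierstrassCurve.HasMultiplicativeReductionAtPrime W q ⟨h⟩) with hMlt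
  have hmemMlt : ∀ {q : ℕ} [hq : Fact q.Prime], W.HasMultiplicativeReductionAtPrime q → q ∈ Mlt := by
    intro q hq hm
    have hqN : q ∣ W.conductorNorm ℤ :=
      (W.dvd_conductorNorm_iff_not_hasGoodReductionAtPrime q).mpr
        (WeierstrassCurve.HasMultiplicativeReduction.not_hasGoodReduction (R := ℤ_[q]) hm)
    exact Finset.mem_filter.mpr ⟨Nat.mem_primeFactors.mpr ⟨hq.out, hqN, hN0⟩, hq.out, hm⟩
  have hMlt_exact : ∀ q ∈ Mlt, q.Prime ∧ q ∣ W.conductorNorm ℤ ∧ ¬ q ^ 2 ∣ W.conductorNorm ℤ := by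
    intro q hq
    obtain ⟨hqN, hqp, hm⟩ := Finset.mem_filter.mp hq
    haveI : Fact q.Prime := ⟨hqp⟩
    exact ⟨hqp, (Nat.mem_primeFactors.mp hqN).2.1, not_sq_dvd_conductorNorm_of_mult W q hm⟩
  have hSMlt : S ⊆ Mlt := by
    intro ℓ hℓ
    obtain ⟨hℓF, hm⟩ := hSmult ℓ hℓ
    exact @hmemMlt ℓ hℓF hm
  -- the optimal classical datum of the class (Modularity) and the Pasten package at `p` WITH Lemma 6.18
  obtain ⟨W₀, hW₀, hW₀m, D₀, hfW, hisoW, hmin⟩ :=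
    exists_optimal_modularParametrizationData_of_modularity hnf (W.conductorNorm ℤ) W rfl
  obtain ⟨δ, cA, ι, κ, hδ0, hδ, hcA, hanchorE, h613, hij, h68, hEis, h618⟩ :=
    ribetTakahashiPackageCoker_of_componentOrders hCO PastenShimura2024_lemma_6_8_isogeny_holds hJL W p
      hirr (W.conductorNorm ℤ) W₀ D₀ rfl hfW hmin
  have hp2' : p ≠ 2 := by omega
  obtain ⟨hvA, hι⟩ := rtPackage_valuation_forms W p hirr hcA h68 hEis
  -- (DEG) at `p`: (W) a witness inside or outside `S` (Lemmas 6.15/6.16), or (P) the pairing (Lemma 6.18)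
  obtain ⟨n, hn⟩ := id hSeven
  have hcard : S.card = 2 * n := by omega
  -- (DEG) at `p` from the `p`-ANCHOR (§4): on `S ∋ p` EVERY cokernel term is a `p`-unit, so the `p`-last telescope needs no datum
  have hdeg : padicValNat p (δ ∅) =
      padicValNat p (δ S) + ∑ x ∈ S, padicValNat p (padicValInt x W.minimalDiscriminantInt) :=
    PAnchor.padicValNat_delta_empty_eq_of_self_mem h613 hδ hcA hij hvA hι h618 hp2' n S hSMlt hcard (Or.inr hpS)
  -- the SUPPLIED frame: `S` inert (so `p` inert), every other bad prime split, `|d_K| > 4`, the twin and its `≥`-half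
  obtain ⟨K, _, _, Wd, _, hCd, Cd, hK, hdisc, hinert, hsplitN, hLt, hWd, qS, hqS, hvqS⟩ := hTL S hSmult hSeven
  have h2 := hK.1
  -- the supplied frame has `|d_K| > 4`, i.e. `d_K < −4` (imaginary quadratic): the B6D hypothesis of the display binder
  have h4 : NumberField.discr K < -4 := by
    haveI : IsTotallyComplex K := hK.2
    have hneg : NumberField.discr K < 0 := discr_neg_of_finrank_eq_two K hK.1
    have habs : ((NumberField.discr K).natAbs : ℤ) = -NumberField.discr K :=
      Int.ofNat_natAbs_of_nonpos hneg.le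
    have : (4 : ℤ) < ((NumberField.discr K).natAbs : ℤ) := by exact_mod_cast hdisc
    omega
  -- `w_K = 2`, prime to the odd `p`
  have hμ : ¬ p ∣ Units.torsionOrder K := by
    rw [Literature.NumberTheory.DiophantineGeometry.torsionOrder_eq_two_of_discr_lt hK.1 h4]
    intro hdvd
    exact hp2 ((Nat.prime_dvd_prime_iff_eq hp Nat.prime_two).mp hdvd)
  have hSin : ∀ ℓ ∈ S, ∃ _ : Fact ℓ.Prime, Mult W ℓ ∧
      ((ℓ ≠ 2 ∧ jacobiSym (NumberField.discr K) ℓ = -1) ∨ (ℓ = 2 ∧ NumberField.discr K % 8 = 5)) := by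
    intro ℓ hℓ
    obtain ⟨hℓF, hm⟩ := hSmult ℓ hℓ
    obtain ⟨hn, hd⟩ := hinert ℓ hℓ
    refine ⟨hℓF, hm, ?_⟩
    have hn' : ((Ideal.span {(ℓ : ℤ)}).primesOver (𝓞 K)).ncard ≠ 2 := by rw [hn]; decide
    by_cases hℓ2 : ℓ = 2
    · subst hℓ2
      have hn2 : ((Ideal.span {(2 : ℤ)}).primesOver (𝓞 K)).ncard ≠ 2 := by
        simpa only [Nat.cast_ofNat] using hn'
      have hd2 : ¬ (2 : ℤ) ∣ NumberField.discr K := by simpa only [Nat.cast_ofNat] using hd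
      exact Or.inr ⟨rfl, discr_emod_eight_eq_five_of_ncard_ne_two h2 hn2 hd2⟩
    · exact Or.inl ⟨hℓ2, jacobiSym_discr_eq_neg_one_of_ncard_ne_two h2 hℓF.out hℓ2 hn' hd⟩
  have hsplit : ∀ (ℓ : ℕ) [Fact ℓ.Prime], ¬ W.HasGoodReductionAtPrime ℓ → ℓ ∉ S →
      IsSquare (algebraMap ℚ ℚ_[ℓ] (NumberField.discr K : ℚ)) := by
    intro ℓ hℓF hg hℓS
    have hℓN : ℓ ∣ W.conductorNorm ℤ := (W.dvd_conductorNorm_iff_not_hasGoodReductionAtPrime ℓ).mpr hg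
    exact isSquare_discr_padic_of_ncard_eq_two h2 ℓ (hsplitN ℓ hℓF.out hℓN hℓS)
  -- an ODD ramified good prime is `≥ 5` unless `p ≥ 5` (if it is `3` then `p ≠ 3`: `p` is bad)
  have h5 : ∀ (q : ℕ) [Fact q.Prime], (q : ℤ) ∣ NumberField.discr K → W.HasGoodReductionAtPrime q →
      q ≠ 2 → 5 ≤ q ∨ 5 ≤ p := by
    intro q hqF _ hgood hq2
    have hq : q.Prime := hqF.out
    by_cases hq3 : q = 3
    · subst hq3
      right
      have hp3 : p ≠ 3 := by
        rintro rfl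
        exact WeierstrassCurve.HasMultiplicativeReduction.not_hasGoodReduction (R := ℤ_[3]) hmult hgood
      exact hp.five_le_of_ne_two_of_ne_three hp2 hp3
    · exact Or.inl (hq.five_le_of_ne_two_of_ne_three hq2 hq3)
  -- `p` is INERT in `K`: `(d_K/p) = −1`
  obtain ⟨hnp, hdp⟩ := hinert p hpS
  have hJp : jacobiSym (NumberField.discr K) p = -1 :=
    jacobiSym_discr_eq_neg_one_of_ncard_ne_two h2 hp hp2 (by rw [hnp]; decide) hdp
  -- a globally minimal model of the twist, differing from the twisted equation by a `p`-unit
  have hD0 : (NumberField.discr K : ℚ) ≠ 0 := by exact_mod_cast NumberField.discr_ne_zero K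
  haveI hEt : (W.quadraticTwist (NumberField.discr K : ℚ)).IsElliptic :=
    W.isElliptic_quadraticTwist hD0
  have hu : padicValRat p (Cd.u : ℚ) = 0 :=
    padicValRat_u_eq_zero_of_twist_minimal_of_jacobiSym W p hp2 K hJp Cd hWd
  -- torsion: `p ∤ #E(ℚ)_tors`, `p ∤ #E^{d}(ℚ)_tors` (both `E[p]`, `E^{d}[p]` irreducible)
  have htW : ¬ p ∣ W.torsionOrder := not_dvd_torsionOrder_of_irr W p hirr
  have hirrd : Wd.HasIrreducibleModPGaloisRep p :=
    hasIrreducibleModPGaloisRep_twist_model W p K h2 hirr Cd hWd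
  have htd : ¬ p ∣ Wd.torsionOrder := not_dvd_torsionOrder_of_irr Wd p hirrd
  -- a classical parametrisation datum with `p ∤ c` (Mazur 1978 Cor. 4.1 + Néron)
  have hpN2 : ¬ p ^ 2 ∣ W.conductorNorm ℤ := not_sq_dvd_conductorNorm_of_mult W p hmult
  obtain ⟨Dt, hc⟩ := exists_modularParametrizationData_not_dvd hnf hMaz hNS W rfl hp hp2 hpN2 hirr
  -- the rank-0 twist's algebraic central value (modular symbols)
  have hmodP : nonempty_modularParametrizationData :=
    nonempty_modularParametrizationData_iff_exists_isNewformOf_unconditional.mpr hnf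
  obtain ⟨qd, hqd⟩ :=
    Summit.BirchSwinnertonDyer.Rank1Residual.X1.RankZeroPartner.exists_rat_entireLFunction_one_div_realPeriodRat
      hmodP Wd
  ---------------------------------------------------------------- the Shimura curve `X_{N⁺,N⁻}`, `p ∣ N⁻ = ∏ S`
  have hSexact : ∀ ℓ ∈ S, ℓ.Prime ∧ ℓ ∣ W.conductorNorm ℤ ∧ ¬ ℓ ^ 2 ∣ W.conductorNorm ℤ :=
    fun ℓ hℓ ↦ hMlt_exact ℓ (hSMlt hℓ)
  -- the chosen class-minimal datum of level `(∏S, N/∏S)` (existential anchor of the package)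
  obtain ⟨X, W', hW', P₀, hP₀, hdegδ⟩ := hanchorE hSMlt hSeven
  haveI := hW'
  ---------------------------------------------------------------- the Heegner point of `X_{N⁺,N⁻}` at `K` (inert display)
  have hSin' : ∀ ℓ ∈ S, ℓ.Prime ∧ ℓ ∣ W.conductorNorm ℤ ∧ ¬ ℓ ^ 2 ∣ W.conductorNorm ℤ ∧
      ((Ideal.span {(ℓ : ℤ)}).primesOver (𝓞 K)).ncard = 1 ∧ ¬ (ℓ : ℤ) ∣ NumberField.discr K := by
    intro ℓ hℓ
    obtain ⟨h1, h2', h3⟩ := hSexact ℓ hℓ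
    obtain ⟨hn, hd⟩ := hinert ℓ hℓ
    exact ⟨h1, h2', h3, hn, hd⟩
  obtain ⟨P, degS, hdegS, hlinkS, hGZP, hUShP⟩ :=
    hHKs (W.conductorNorm ℤ) K S Dt X W' P₀ rfl hK h4 hSeven hSin' hsplitN hpS hc hP₀
  -- the two degree links
  have hlink₁ : padicValNat p Dt.modularDegree = padicValNat p (δ ∅) := by
    rw [hδ0]; exact padicValNat_modularDegree_eq_of_isNewformOf hNS hisoW D₀ hfW hmin hp hirr Dt hc
  have hlink₂ : padicValNat p degS = padicValNat p (δ S) := by rw [hlinkS, hdegδ]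
  ---------------------------------------------------------------- covolume form (Zagier) and (U-Sh) (non-torsion)
  have hGZR := degS_mul_lDerivEK_eq_of_petersson W (W.conductorNorm ℤ) K Dt P hdegS hGZP
  have hUShs : padicValNat p (Nat.card (AddCommGroup.primaryComponent (W.baseChange K).sha p)) +
        2 * padicValNat p ((W.baseChange ℚ_[q₁]).localTamagawaNumber ℤ_[q₁]) ≤
      2 * padicValNat p (AddSubgroup.zmultiples P).index :=
    hUShP (not_isOfFinAddOrder_of_petersson_display hmod W K hr hLt P _ _ hGZP) hq₁S
  ---------------------------------------------------------------- (GZ-Sh₀), (GZ-Sh)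
  obtain ⟨qE, hqE, hqd0, hE, h0⟩ := gzShape₀_of_shimuraGZReal W p (W.conductorNorm ℤ) K Dt P degS
    hGZK hmod hK hp2 hc hμ hr hLt hdegS hGZR Wd Cd hWd hu qd hqd htW htd
  have h₀ : (2 * padicValNat p (AddSubgroup.zmultiples P).index : ℤ) + padicValNat p (δ ∅) =
      padicValRat p qE + padicValRat p qd + padicValNat p (δ S) := by
    rw [← hlink₁, ← hlink₂]; exact h0
  have hGZSh : ∃ qE qd : ℚ, qE ≠ 0 ∧ qd ≠ 0 ∧
      W.leadingLCoeff / ((W.realPeriodRat : ℂ) * (W.regulator : ℂ)) = (qE : ℂ) ∧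
      Wd.entireLFunction 1 / (Wd.realPeriodRat : ℂ) = (qd : ℂ) ∧
      (2 * padicValNat p (AddSubgroup.zmultiples P).index : ℤ) +
          (∑ ℓ ∈ S, padicValNat p (padicValInt ℓ W.minimalDiscriminantInt) : ℕ) =
        padicValRat p qE + padicValRat p qd :=
    ⟨qE, qd, hqE, hqd0, hE, hqd, gzShape_of_gzShape₀_of_deg h₀ hdeg⟩
  ---------------------------------------------------------------- the twist at `p` (inert): Tamagawa bookkeeping with `q₁` exempted
  -- the numeric Tamagawa condition at an ODD prime, any `d_K`, WITH `q₁` EXEMPTED (costs `2·ord_p c_{q₁}(E)`)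
  have hT := padicValNat_tamagawaProduct_add_twist_le_of_inertSet'_binder_of_extraPlace W p hp2 K h2 h5 q₁ hbad₁
    hshape Cd hWd (fun hd hg ↦ binderAtTwo_of_barriosEtAl hBR p hp2 W hg K Cd Wd h2 hd hWd) S hq₁S hSin
    (fun ℓ _ hg hℓS ↦ hsplit ℓ hg hℓS) (fun ℓ _ hℓS h1 hs ↦ hFC ℓ hℓS h1 hs)
  -- the twin's `≥`-half is SUPPLIED at this frame (`hqS`, `hvqS`): no (ram) witness, no Skinner Thm. C, no X11a input
  have hLt' : (W.quadraticTwist (NumberField.discr K : ℚ)).entireLFunction = Wd.entireLFunction := by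
    rw [← hWd, entireLFunction_smul]
  have hLd1 : Wd.entireLFunction 1 ≠ 0 := by rw [← hLt']; exact hLt
  have hfinSd : Wd.ShaFinite := (hGZK Wd (by
    rw [(Wd.analyticRank_eq_zero_iff_holds (hmod Wd)).2 hLd1]; omega)).2
  have hfinW : W.ShaFinite := (hGZK W (by omega)).2
  exact missingUpperBoundAt_of_shimuraShapes_of_saving W p hp2 K h2 Wd ⟨Cd, hWd⟩ hfinW hfinSd P _ _ hT
    ⟨qS, hqS, hvqS⟩ hGZSh hUShs

end Summit.BirchSwinnertonDyer.BirchSwinnertonDyer.Theorems.EulerHalfPAnchor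

end
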